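import Literature.MathematicalPhysics.QuantumFieldTheory.Balaban1983to89.B6Partition118KLevelFineMixedCalc
import Literature.MathematicalPhysics.QuantumFieldTheory.Balaban1983to89.B6Partition118KLevelTorusBinders

/-!
# `Balaban1983to89.B6Partition118KLevelFineMixed` — T. Bałaban, *Propagators and renormalization transformations for lattice gauge theories. II*,
# Commun. Math. Phys. **96** (1984) 223–250 [Balaban1984PropagatorsII], p. 229 (2.36) / p. 239 (2.92) line 1 / p. 247 (2.137): THE MIXED SECOND
# DIFFERENCES OF THE SMOOTH FINE-LATTICE PARTITION `{h_□}` — **`|h_□(x + e_μ + e_ν) − h_□(x + e_μ) − h_□(x + e_ν) + h_□(x)| ≤ C₂ᴹ/(8S_□/5)²`**, `μ ≠ ν`,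
# on the box (`hF`) and on the torus (`hT`, torus translates), and the UNIT STEP OF A FIRST DIFFERENCE in any direction (`μ = ν` allowed:
# `max`-free constant `C₂ˣ = C₂ + C₂ᴹ`) — the size `|∇∇′h_□| ≤ O(1)(ML^jη)^{−2}` of ALL second lattice derivatives of `h_□`, the input of the Hölder
# estimate (2.137) of `∇(h_□G_□h_□)` (the term `(∇h_□)·G_□h_□` differenced at two points)

statement-level skeleton of published theorems with citation tags; proofs where landed; nothing here is a claim about the Yang–Mills mass gap

PDF held: `paper:balaban1984-cmp96-propagators-rt-ii` (journal page = PDF page + 222): p. 229 [PDF 7], p. 239 [PDF 17], p. 247 [PDF 25].  PRINT p. 247: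
*"Reasoning in the same way as in the proof of Proposition 2.2 we obtain Proposition 2.6 … ‖ζ∇GJ‖_α ≤ O(1)(Lʲη)^{1−α}(‖ζ‖_α + |ζ|)e^{−δ₃d(y,y′)}|J| (2.137)"*;
p. 239 (2.92) line 1 *"(K_{□,□′}A)(x) = ([h_□Δ − Δh_□]G_□h_□A)(x) + …"*; [Balaban1983RegularityDecay] §2 p. 577 *"|∂^ηh_j| ≤ O(M⁻¹), |Δ^ηh_j| ≤ O(M⁻²)"*.
The Hölder quotient of `∇_ν(h_□G_□h_□) = (S_νh_□)·∇_ν(G_□h_□) + (∇_νh_□)·G_□h_□` at two points `x, x′` contains `(∇_νh_□)(x) − (∇_νh_□)(x′)`, a sum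
along a lattice path from `x′` to `x` of the second differences `h_□(z + e_μ + e_ν) − h_□(z + e_μ) − h_□(z + e_ν) + h_□(z)` — PURE (`μ = ν`, p38's
`…B6Partition118KLevelFineSecond`) and MIXED (`μ ≠ ν`, THIS FILE); print's `O(1)(ML^jη)^{−2}` for both is the `C^2` size of the product profile.

CITATION HEADER (lean-in-tree rule) — WHAT IS REPRODUCED.  Phase-2 file of the `lit-balaban` typed skeleton (HOME `run/shared/lean/pub/lit-balaban/`), seat
**p22 gen 26**, free-target (2.137)₁ at k levels (HOME/STATUS TAKING 2026-08-23T22:15Z, r03 NO OBJECTION 22:25Z); SKELETON rows **B6.Eq2.36** ×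
**B5.Eq1.118** × **B6.Prop2.6** (cells only; decls of record untouched).  File 4 of p38's fine-partition family (`…Fine`, `…FineSizes`, `…FineSecond`;
the four-point real algebra and the product structure `|□θ_□| ≤ D₁²/(8S/5)²` are file 4a, `…B6Partition118KLevelFineMixedCalc`):
* §3 **`abs_hF_mixed_diff_le`**: `|hF □ (x + e_μ + e_ν) − hF □ (x + e_μ) − hF □ (x + e_ν) + hF □ x| ≤ C2M d ℓ/(8S_□/5)²`, `C2M = (1 + 2·3^{d+2})²D₁²L⁴`,
  by p38's normalisation argument across the `≤ 3^{d+2}` active cubes of comparable scales, at four points (every active bump has axis moves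
  `≤ α = D₁L²/(8S/5)` and mixed differences `≤ α²`, so the normalising sum has edges `≤ 2·3^{d+2}α` and `|□N| ≤ 3^{d+2}·4α²`);
* §4 the torus forms with p21's translates: `abs_hT_mixed_diff_le` (`μ ≠ ν`) and **`abs_hT_diff_step_le`** (ANY `μ, ν`; constant `C2X = C2F + C2M`):
  `|h^T_□(z + e_μ + e_ν) − h^T_□(z + e_μ) − h^T_□(z + e_ν) + h^T_□(z)| ≤ C2X/(8S/5)²` — the unit step of `z ↦ h^T_□(z + e_ν) − h^T_□(z)`.
No new definition beyond two closed-form constants (`C2M`, `C2X`); no `def … : Prop`; standard axioms.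
HONEST SCOPE. Constants `d`-, `L`-dependent, `k`-, `M_h`-independent, not optimised; integer box / torus of p21's family; nothing on d = 4 or the continuum;
NOT summit progress.  Unit `lit-balaban-p22` (gen 26), 2026-08-23.
-/

namespace Literature.MathematicalPhysics.QuantumFieldTheory.Balaban1983to89.B6Partition118KLevelFineMixed

open Finset
open Literature.MathematicalPhysics.QuantumFieldTheory.Balaban1983to89.B4ContourShift (supNorm)
open Literature.MathematicalPhysics.QuantumFieldTheory.Balaban1983to89.B4Reflection242 (boxDom mem_boxDom blk)
open Literature.MathematicalPhysics.QuantumFieldTheory.Balaban1983to89.B6MultiLevelBoxOperator (Domains N0 bigSide bigSide_eq one_le_bigSide)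
open Literature.MathematicalPhysics.QuantumFieldTheory.Balaban1983to89.B6MultiLevelTorusOperator
  (TDomains tshift tshift_tshift tshift_zero tshift_val tshift_val_of_mem unitVec one_le_of_mem)
open Literature.MathematicalPhysics.QuantumFieldTheory.Balaban1983to89.B6Geom246MultiLevelBox (bset blkOf toR supNorm_eq_dist)
open Literature.MathematicalPhysics.QuantumFieldTheory.Balaban1983to89.B6Cover236MultiLevelBlocks (cubes side side_eq side_pos ctr)
open Literature.MathematicalPhysics.QuantumFieldTheory.Balaban1983to89.B4PartitionUnity22 (hprof contDiff_hprof hasCompactSupport_hprof D1 D1_nonneg)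
open Literature.MathematicalPhysics.QuantumFieldTheory.Balaban1983to89.B6Partition118KLevelFine
  (sF sF_pos thetaF thetaF_nonneg thetaF_le_one dist_lt_of_thetaF_ne_zero abs_thetaF_axis_diff_le nsqF one_le_nsqF hF)
open Literature.MathematicalPhysics.QuantumFieldTheory.Balaban1983to89.B6Partition118KLevelFineSizes
  (abs_sq_sub_sq_le two_le_side card_collar_le sF_le_Lsq_mul_sF dist_collar_of_near)
open Literature.MathematicalPhysics.QuantumFieldTheory.Balaban1983to89.B6Partition118KLevelFineSecond (C2F C2F_nonneg)
open Literature.MathematicalPhysics.QuantumFieldTheory.Balaban1983to89.B6Partition118KLevelFineMixedCalc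
  (quot_mixed_diff_bound abs_sq_mixed_diff_le abs_thetaF_mixed_diff_le)
open Literature.MathematicalPhysics.QuantumFieldTheory.Balaban1983to89.B6TorusDepthDistance (SiteDeep)
open Literature.MathematicalPhysics.QuantumFieldTheory.Balaban1983to89.B6Partition118KLevelTorus (hT)
open Literature.MathematicalPhysics.QuantumFieldTheory.Balaban1983to89.B6Partition118KLevelTorusCentral
open Literature.MathematicalPhysics.QuantumFieldTheory.Balaban1983to89.B6Partition118KLevelTorusBinders
  (sF_cc σch_symm_tshift siteDeep_three_of_hF_ne_zero abs_hT_second_diff_le)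

variable {d : ℕ} {ℓ Mh k R : ℕ} {P : Fin (d + 1) → ℕ} (D : Domains d ℓ Mh k P R)

/-! ## §3  Mixed second differences of `h_□` on the box -/

/-- the constant `C₂ᴹ = (1 + 2·3^{d+2})²·D₁²·L⁴` of the mixed second differences. OURS. [cite: Balaban1984PropagatorsII, p.247 («O(1)»), bookkeeping] -/
noncomputable def C2M (d ℓ : ℕ) : ℝ := (1 + 2 * 3 ^ (d + 2)) ^ 2 * D1 hprof ^ 2 * ((ℓ : ℝ) + 1) ^ 4

/-- `C₂ᴹ ≥ 0`. [cite: Balaban1984PropagatorsII, p.247, bookkeeping] -/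
theorem C2M_nonneg (d ℓ : ℕ) : 0 ≤ C2M d ℓ := by unfold C2M; positivity

/-- an axis move of an integer point, seen in `ℝ^{d+1}`. [folklore] -/
private theorem toR_update (z : Fin (d + 1) → ℤ) (μ : Fin (d + 1)) (t : ℤ) :
    toR (Function.update z μ (z μ + t)) = Function.update (toR z) μ (toR z μ + t) := by
  funext ν
  by_cases h : ν = μ
  · subst h; simp [toR]
  · simp [toR, Function.update_of_ne h]

/-- two integer points whose coordinates differ by at most `1` are at distance `≤ 1` in `ℝ^{d+1}`. [folklore] -/
private theorem dist_toR_le_one {z z' : Fin (d + 1) → ℤ} (h : ∀ ν, |z' ν - z ν| ≤ 1) : dist (toR z) (toR z') ≤ 1 := by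
  refine (dist_pi_le_iff zero_le_one).2 fun ν => ?_
  rw [Real.dist_eq, abs_sub_comm]
  have := h ν
  simp only [toR]
  exact_mod_cast this

/-- **`|h_□(x + e_μ + e_ν) − h_□(x + e_μ) − h_□(x + e_ν) + h_□(x)| ≤ C₂ᴹ/(8S/5)²`** for distinct axes `μ ≠ ν` at every fine site whose three forward
neighbours are box sites («|∇∇′h_□| ≤ O(1)(ML^jη)^{−2}»: the four-point product rule across the `≤ 3^{d+2}` active cubes of comparable scales).
[cite: Balaban1984PropagatorsII, p.247 (2.137) / after (2.134), (2.92) p.239 line 1; Balaban1983RegularityDecay, §2 p.577] -/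
theorem abs_hF_mixed_diff_le (hℓ : 1 ≤ ℓ) (hMh : 1 ≤ Mh) (hR : 2 * (ℓ + 1) ≤ R) (i : ↥(cubes D)) {μ ν : Fin (d + 1)} (hμν : μ ≠ ν)
    {x x10 x01 x11 : ↥(boxDom (N0 ℓ Mh k P))} (h10 : x10.1 = Function.update x.1 μ (x.1 μ + 1))
    (h01 : x01.1 = Function.update x.1 ν (x.1 ν + 1))
    (h11 : x11.1 = Function.update (Function.update x.1 μ (x.1 μ + 1)) ν (x.1 ν + 1)) :
    |hF D i x11 - hF D i x10 - hF D i x01 + hF D i x| ≤ C2M d ℓ / sF D i ^ 2 := by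
  have hs := sF_pos D hMh i
  have hS2 := two_le_side D hℓ hMh i
  have hD1 := D1_nonneg contDiff_hprof hasCompactSupport_hprof
  have hL1 : (1 : ℝ) ≤ ((ℓ : ℝ) + 1) ^ 2 := by
    have h0 : (0 : ℝ) ≤ ℓ := by positivity
    nlinarith
  -- the four points in `ℝ^{d+1}`
  have eR10 : toR x10.1 = Function.update (toR x.1) μ (toR x.1 μ + 1) := by rw [h10, toR_update]; push_cast; rfl
  have eR01 : toR x01.1 = Function.update (toR x.1) ν (toR x.1 ν + 1) := by rw [h01, toR_update]; push_cast; rfl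
  have eR11 : toR x11.1 = Function.update (Function.update (toR x.1) μ (toR x.1 μ + 1)) ν (toR x.1 ν + 1) := by
    have ey : Function.update (Function.update x.1 μ (x.1 μ + 1)) ν (x.1 ν + 1) =
        Function.update (Function.update x.1 μ (x.1 μ + 1)) ν ((Function.update x.1 μ (x.1 μ + 1)) ν + 1) := by
      rw [Function.update_of_ne hμν.symm]
    rw [h11, ey, toR_update, toR_update, Function.update_of_ne hμν.symm]
    push_cast
    rfl
  -- `x11` as an axis move of `x10` (axis `ν`) and of `x01` (axis `μ`)
  have eR11a : toR x11.1 = Function.update (toR x10.1) ν (toR x10.1 ν + 1) := by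
    rw [eR11, eR10, Function.update_of_ne hμν.symm]
  have eR11b : toR x11.1 = Function.update (toR x01.1) μ (toR x01.1 μ + 1) := by
    rw [eR11, eR01, Function.update_of_ne hμν, Function.update_comm hμν]
  have hd10 : dist (toR x.1) (toR x10.1) ≤ 1 :=
    dist_toR_le_one fun κ => by rw [h10]; by_cases hκ : κ = μ <;> simp [hκ]
  have hd01 : dist (toR x.1) (toR x01.1) ≤ 1 :=
    dist_toR_le_one fun κ => by rw [h01]; by_cases hκ : κ = ν <;> simp [hκ]
  have hd11 : dist (toR x.1) (toR x11.1) ≤ 1 := by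
    refine dist_toR_le_one fun κ => ?_
    rw [h11]; by_cases hκ : κ = ν
    · subst hκ; simp
    · by_cases hκ' : κ = μ
      · subst hκ'; simp [Function.update_of_ne hκ]
      · simp [Function.update_of_ne hκ, Function.update_of_ne hκ']
  -- trivial when `θ_□` vanishes at the four sites
  by_cases h0 : thetaF D i (toR x.1) = 0 ∧ thetaF D i (toR x10.1) = 0 ∧ thetaF D i (toR x01.1) = 0 ∧ thetaF D i (toR x11.1) = 0
  · have e1 : hF D i x = 0 := by unfold hF; rw [h0.1, zero_div]
    have e2 : hF D i x10 = 0 := by unfold hF; rw [h0.2.1, zero_div]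
    have e3 : hF D i x01 = 0 := by unfold hF; rw [h0.2.2.1, zero_div]
    have e4 : hF D i x11 = 0 := by unfold hF; rw [h0.2.2.2, zero_div]
    rw [e1, e2, e3, e4]; norm_num; exact div_nonneg (C2M_nonneg d ℓ) (sq_nonneg _)
  have hxi : dist (toR x.1) (ctr D i) < side D i + 1 := by
    rcases not_and_or.1 h0 with h | h
    · have := dist_lt_of_thetaF_ne_zero D hMh h; linarith
    rcases not_and_or.1 h with h | h
    · exact dist_collar_of_near D (ρ := 1) (dist_lt_of_thetaF_ne_zero D hMh h) (by rw [dist_comm]; exact hd10)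
    rcases not_and_or.1 h with h | h
    · exact dist_collar_of_near D (ρ := 1) (dist_lt_of_thetaF_ne_zero D hMh h) (by rw [dist_comm]; exact hd01)
    · exact dist_collar_of_near D (ρ := 1) (dist_lt_of_thetaF_ne_zero D hMh h) (by rw [dist_comm]; exact hd11)
  have hxi' : dist (toR x.1) (ctr D i) < 3 / 2 * side D i := by linarith
  classical
  set A := Finset.univ.filter fun c : ↥(cubes D) => dist (toR x.1) (ctr D c) < 3 / 2 * side D c with hA
  have hAcard : (#A : ℝ) ≤ 3 ^ (d + 2) := by exact_mod_cast card_collar_le D hMh hR x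
  have hmemA : ∀ c : ↥(cubes D), (thetaF D c (toR x.1) ≠ 0 ∨ thetaF D c (toR x10.1) ≠ 0 ∨ thetaF D c (toR x01.1) ≠ 0 ∨
      thetaF D c (toR x11.1) ≠ 0) → c ∈ A := by
    intro c hc
    rw [hA, Finset.mem_filter]
    refine ⟨Finset.mem_univ _, ?_⟩
    have hSc := side_pos D hMh c
    have hS2c := two_le_side D hℓ hMh c
    rcases hc with h | h | h | h
    · have := dist_lt_of_thetaF_ne_zero D hMh h; linarith
    · have := dist_collar_of_near D (ρ := 1) (dist_lt_of_thetaF_ne_zero D hMh h) (by rw [dist_comm]; exact hd10); linarith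
    · have := dist_collar_of_near D (ρ := 1) (dist_lt_of_thetaF_ne_zero D hMh h) (by rw [dist_comm]; exact hd01); linarith
    · have := dist_collar_of_near D (ρ := 1) (dist_lt_of_thetaF_ne_zero D hMh h) (by rw [dist_comm]; exact hd11); linarith
  -- sizes: every active bump has axis moves `≤ α = D₁L²/(8S/5)` everywhere and mixed differences `≤ β = α²`
  set α : ℝ := D1 hprof * ((ℓ : ℝ) + 1) ^ 2 / sF D i with hα
  set β : ℝ := α ^ 2 with hβ
  have hα0 : 0 ≤ α := by positivity
  have hαc : ∀ c ∈ A, D1 hprof / sF D c ≤ α := by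
    intro c hc
    have hsc := sF_pos D hMh c
    have hcmp := sF_le_Lsq_mul_sF D hMh hR hxi' (Finset.mem_filter.1 hc).2
    have hinv : 1 / sF D c ≤ ((ℓ : ℝ) + 1) ^ 2 / sF D i := by
      rw [div_le_div_iff₀ hsc hs]; nlinarith
    calc D1 hprof / sF D c = D1 hprof * (1 / sF D c) := by ring
      _ ≤ D1 hprof * (((ℓ : ℝ) + 1) ^ 2 / sF D i) := mul_le_mul_of_nonneg_left hinv hD1
      _ = α := by rw [hα]; ring
  have hedge : ∀ c ∈ A, ∀ (q : Fin (d + 1) → ℝ) (κ : Fin (d + 1)), |thetaF D c (Function.update q κ (q κ + 1)) - thetaF D c q| ≤ α := by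
    intro c hc q κ
    have h := abs_thetaF_axis_diff_le D hMh c q κ 1
    rw [abs_one, mul_one] at h
    exact h.trans (hαc c hc)
  have hmix : ∀ c ∈ A, |thetaF D c (toR x11.1) - thetaF D c (toR x10.1) - thetaF D c (toR x01.1) + thetaF D c (toR x.1)| ≤ β := by
    intro c hc
    have h := abs_thetaF_mixed_diff_le D hMh c (toR x.1) hμν 1 1
    rw [← eR11, ← eR10, ← eR01, abs_one, mul_one] at h
    have hc0 : 0 ≤ D1 hprof / sF D c := div_nonneg hD1 (sF_pos D hMh c).le
    calc _ ≤ D1 hprof / sF D c * (D1 hprof / sF D c) := h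
      _ ≤ α * α := mul_le_mul (hαc c hc) (hαc c hc) hc0 hα0
      _ = β := by rw [hβ]; ring
  -- the four edges of every active bump
  have hE10 : ∀ c ∈ A, |thetaF D c (toR x10.1) - thetaF D c (toR x.1)| ≤ α := fun c hc => by
    have h := hedge c hc (toR x.1) μ; rwa [← eR10] at h
  have hE01 : ∀ c ∈ A, |thetaF D c (toR x01.1) - thetaF D c (toR x.1)| ≤ α := fun c hc => by
    have h := hedge c hc (toR x.1) ν; rwa [← eR01] at h
  have hE11a : ∀ c ∈ A, |thetaF D c (toR x11.1) - thetaF D c (toR x10.1)| ≤ α := fun c hc => by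
    have h := hedge c hc (toR x10.1) ν; rwa [← eR11a] at h
  have hE11b : ∀ c ∈ A, |thetaF D c (toR x11.1) - thetaF D c (toR x01.1)| ≤ α := fun c hc => by
    have h := hedge c hc (toR x01.1) μ; rwa [← eR11b] at h
  -- the normalising sums: edges and mixed differences live on `A`
  have hsumA : ∀ g : ↥(cubes D) → ℝ, (∀ c ∉ A, g c = 0) → ∑ c, g c = ∑ c ∈ A, g c := by
    intro g hg
    rw [← Finset.sum_filter_add_sum_filter_not Finset.univ (fun c => c ∈ A),
      Finset.sum_eq_zero (fun c hc => hg c (Finset.mem_filter.1 hc).2), add_zero, Finset.filter_mem_eq_inter, Finset.univ_inter]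
  have hout : ∀ c ∉ A, thetaF D c (toR x.1) = 0 ∧ thetaF D c (toR x10.1) = 0 ∧ thetaF D c (toR x01.1) = 0 ∧ thetaF D c (toR x11.1) = 0 := by
    intro c hc
    refine ⟨?_, ?_, ?_, ?_⟩
    · by_contra h; exact hc (hmemA c (Or.inl h))
    · by_contra h; exact hc (hmemA c (Or.inr (Or.inl h)))
    · by_contra h; exact hc (hmemA c (Or.inr (Or.inr (Or.inl h))))
    · by_contra h; exact hc (hmemA c (Or.inr (Or.inr (Or.inr h))))
  have hNedge : ∀ (u v : ↥(boxDom (N0 ℓ Mh k P))), (∀ c ∉ A, thetaF D c (toR u.1) = 0 ∧ thetaF D c (toR v.1) = 0) →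
      (∀ c ∈ A, |thetaF D c (toR u.1) - thetaF D c (toR v.1)| ≤ α) → |nsqF D u - nsqF D v| ≤ #A * (2 * α) := by
    intro u v huv hle
    unfold nsqF
    rw [← Finset.sum_sub_distrib, hsumA _ (fun c hc => by rw [(huv c hc).1, (huv c hc).2]; ring)]
    calc |∑ c ∈ A, (thetaF D c (toR u.1) ^ 2 - thetaF D c (toR v.1) ^ 2)| ≤ ∑ c ∈ A, |thetaF D c (toR u.1) ^ 2 - thetaF D c (toR v.1) ^ 2| :=
          Finset.abs_sum_le_sum_abs _ _
      _ ≤ ∑ _c ∈ A, 2 * α := Finset.sum_le_sum fun c hc =>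
          (abs_sq_sub_sq_le (thetaF_nonneg D c _) (thetaF_le_one D c _) (thetaF_nonneg D c _) (thetaF_le_one D c _)).trans
            (mul_le_mul_of_nonneg_left (hle c hc) zero_le_two)
      _ = _ := by rw [Finset.sum_const, nsmul_eq_mul]
  have hN10 : |nsqF D x10 - nsqF D x| ≤ #A * (2 * α) :=
    hNedge x10 x (fun c hc => ⟨(hout c hc).2.1, (hout c hc).1⟩) hE10
  have hN01 : |nsqF D x01 - nsqF D x| ≤ #A * (2 * α) :=
    hNedge x01 x (fun c hc => ⟨(hout c hc).2.2.1, (hout c hc).1⟩) hE01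
  have hN11 : |nsqF D x11 - nsqF D x10| ≤ #A * (2 * α) :=
    hNedge x11 x10 (fun c hc => ⟨(hout c hc).2.2.2, (hout c hc).2.1⟩) hE11a
  have hNN : |nsqF D x11 - nsqF D x10 - nsqF D x01 + nsqF D x| ≤ #A * (2 * β + 2 * α ^ 2) := by
    unfold nsqF
    have e : ∑ c, thetaF D c (toR x11.1) ^ 2 - ∑ c, thetaF D c (toR x10.1) ^ 2 - ∑ c, thetaF D c (toR x01.1) ^ 2 +
        ∑ c, thetaF D c (toR x.1) ^ 2 =
        ∑ c, (thetaF D c (toR x11.1) ^ 2 - thetaF D c (toR x10.1) ^ 2 - thetaF D c (toR x01.1) ^ 2 + thetaF D c (toR x.1) ^ 2) := by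
      rw [← Finset.sum_sub_distrib, ← Finset.sum_sub_distrib, ← Finset.sum_add_distrib]
    rw [e, hsumA _ (fun c hc => by rw [(hout c hc).1, (hout c hc).2.1, (hout c hc).2.2.1, (hout c hc).2.2.2]; ring)]
    calc |∑ c ∈ A, (thetaF D c (toR x11.1) ^ 2 - thetaF D c (toR x10.1) ^ 2 - thetaF D c (toR x01.1) ^ 2 + thetaF D c (toR x.1) ^ 2)|
        ≤ ∑ c ∈ A, |thetaF D c (toR x11.1) ^ 2 - thetaF D c (toR x10.1) ^ 2 - thetaF D c (toR x01.1) ^ 2 + thetaF D c (toR x.1) ^ 2| :=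
          Finset.abs_sum_le_sum_abs _ _
      _ ≤ ∑ _c ∈ A, (2 * β + 2 * α ^ 2) := Finset.sum_le_sum fun c hc => by
          refine (abs_sq_mixed_diff_le (thetaF_nonneg D c _) (thetaF_le_one D c _) (thetaF_nonneg D c _) (thetaF_le_one D c _)).trans ?_
          have h1 := hmix c hc
          have h2 := mul_le_mul (hE11b c hc) (hE01 c hc) (abs_nonneg _) hα0
          have h3 := mul_le_mul (hE11a c hc) (hE10 c hc) (abs_nonneg _) hα0
          nlinarith
      _ = _ := by rw [Finset.sum_const, nsmul_eq_mul]
  -- the quotient rule with the sizes plugged in at `m = 3^{d+2} ≥ #A`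
  have hiA : i ∈ A := by rw [hA, Finset.mem_filter]; exact ⟨Finset.mem_univ _, hxi'⟩
  have hm9 : (0 : ℝ) ≤ 3 ^ (d + 2) := by positivity
  have h2α : 0 ≤ 2 * α := mul_nonneg zero_le_two hα0
  have h4 : |nsqF D x10 - nsqF D x| ≤ 2 * 3 ^ (d + 2) * α :=
    hN10.trans (by nlinarith [mul_le_mul_of_nonneg_right hAcard h2α])
  have h5 : |nsqF D x11 - nsqF D x10| ≤ 2 * 3 ^ (d + 2) * α :=
    hN11.trans (by nlinarith [mul_le_mul_of_nonneg_right hAcard h2α])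
  have h6 : |nsqF D x01 - nsqF D x| ≤ 2 * 3 ^ (d + 2) * α :=
    hN01.trans (by nlinarith [mul_le_mul_of_nonneg_right hAcard h2α])
  have h7 : |nsqF D x11 - nsqF D x10 - nsqF D x01 + nsqF D x| ≤ 3 ^ (d + 2) * (2 * β + 2 * α ^ 2) :=
    hNN.trans (mul_le_mul_of_nonneg_right hAcard (by positivity))
  have key := quot_mixed_diff_bound (thetaF_nonneg D i _) (thetaF_le_one D i _) (one_le_nsqF D hMh x) (one_le_nsqF D hMh x10)
    (one_le_nsqF D hMh x01) (one_le_nsqF D hMh x11) hα0 hm9 (hE11b i hiA) (hE11a i hiA) (hmix i hiA) h4 h5 h6 h7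
  have e : hF D i x11 - hF D i x10 - hF D i x01 + hF D i x =
      thetaF D i (toR x11.1) / Real.sqrt (nsqF D x11) - thetaF D i (toR x10.1) / Real.sqrt (nsqF D x10) -
        thetaF D i (toR x01.1) / Real.sqrt (nsqF D x01) + thetaF D i (toR x.1) / Real.sqrt (nsqF D x) := rfl
  rw [e]
  refine key.trans (le_of_eq ?_)
  rw [hβ, hα]; unfold C2M
  field_simp
  ring

/-! ## §4  The torus forms with p21's translates -/

section Torus

variable {D}
variable {DT : TDomains d ℓ Mh k P R}

/-- `x + e_μ` as an update. [folklore] -/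
private theorem add_single_eq_update (x : Fin (d + 1) → ℤ) (μ : Fin (d + 1)) (t : ℤ) :
    x + Pi.single μ t = Function.update x μ (x μ + t) := by
  funext ν
  by_cases h : ν = μ
  · subst h; simp
  · simp [Function.update_of_ne h, Pi.single_eq_of_ne h]

/-- at a site on the far wall of the fundamental box in the coordinate `i`, none of the forward torus translates by `0/1`-vectors carries `h_□`
(carriers are `3`-deep). [cite: Balaban1984PropagatorsII, (2.36) p.229, bookkeeping] -/
private theorem hF_tshift_eq_zero_of_wall (hℓ : 1 ≤ ℓ) (hMh : 2 ≤ Mh) (hR : 2 * (ℓ + 1) ≤ R) (hP5 : ∀ μ, 5 ≤ P μ) {hMh1 : 1 ≤ Mh}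
    {hP4 : ∀ μ, 4 ≤ P μ} (c : ↥(cubes DT.toDomains)) {x : ↥(boxDom (N0 ℓ Mh k P))} {i : Fin (d + 1)}
    (hx : (N0 ℓ Mh k P i : ℤ) ≤ x.1 i + 1) (t : Fin (d + 1) → ℤ) (ht : t i = 0 ∨ t i = 1) :
    hF (Dch DT c) (cc DT hMh1 hP4 c) (tshift (N0 ℓ Mh k P) t x) = 0 := by
  by_contra h
  have hd := (siteDeep_three_of_hF_ne_zero hℓ hMh hR hP5 c h) i
  rw [tshift_val] at hd
  have hxi := (mem_boxDom.1 x.2) i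
  have hval : x.1 i = (N0 ℓ Mh k P i : ℤ) - 1 := by omega
  simp only [B6MultiLevelTorusOperator.twrap, Pi.add_apply, hval] at hd
  rcases ht with h0 | h1
  · rw [h0, add_zero, Int.emod_eq_of_lt (by omega) (by omega)] at hd
    omega
  · rw [h1, sub_add_cancel, Int.emod_self] at hd
    omega

/-- **THE MIXED SECOND DIFFERENCE WITH TORUS NEIGHBOURS**, `μ ≠ ν`:
`|h^T_□(z + e_μ + e_ν) − h^T_□(z + e_μ) − h^T_□(z + e_ν) + h^T_□(z)| ≤ C₂ᴹ/(8S/5)²` with the torus translates `tshift` (`L ≥ 2`, `M_h ≥ 2`, `R ≥ 2L`,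
`P_μ ≥ 5`). [cite: Balaban1984PropagatorsII, p.247 (2.137) («|∇∇′h_□| ≤ O(1)(ML^jη)^{−2}», our reading), (2.92) p.239 line 1] -/
theorem abs_hT_mixed_diff_le (hℓ : 1 ≤ ℓ) (hMh : 2 ≤ Mh) (hR : 2 * (ℓ + 1) ≤ R) (hP5 : ∀ μ, 5 ≤ P μ) (c : ↥(cubes DT.toDomains))
    {μ ν : Fin (d + 1)} (hμν : μ ≠ ν) (z : ↥(boxDom (N0 ℓ Mh k P))) :
    |hT DT c (tshift (N0 ℓ Mh k P) (unitVec ν) (tshift (N0 ℓ Mh k P) (unitVec μ) z)) - hT DT c (tshift (N0 ℓ Mh k P) (unitVec μ) z) -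
        hT DT c (tshift (N0 ℓ Mh k P) (unitVec ν) z) + hT DT c z| ≤ C2M d ℓ / (8 / 5 * (bigSide ℓ Mh c.1.1 : ℝ)) ^ 2 := by
  have hMh1 : 1 ≤ Mh := le_trans (by norm_num) hMh
  have hP4 : ∀ μ, 4 ≤ P μ := fun μ => le_trans (by norm_num) (hP5 μ)
  have hC : 0 ≤ C2M d ℓ / (8 / 5 * (bigSide ℓ Mh c.1.1 : ℝ)) ^ 2 := div_nonneg (C2M_nonneg d ℓ) (by positivity)
  simp only [hT_eq_hF_cc hMh1 hP4 c, σch_symm_tshift]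
  rw [← sF_cc hMh1 hP4 c]
  set x := (σch DT c).symm z with hx
  by_cases hwall : ∀ i, x.1 i + 1 < (N0 ℓ Mh k P i : ℤ)
  · -- off the far walls: the three forward translates are the lattice points
    have hmem : ∀ t : Fin (d + 1) → ℤ, (∀ i, t i = 0 ∨ t i = 1) → x.1 + t ∈ boxDom (N0 ℓ Mh k P) := by
      intro t ht
      refine mem_boxDom.2 fun i => ?_
      have h1 := (mem_boxDom.1 x.2) i
      have h2 := hwall i
      rcases ht i with h | h <;> simp only [Pi.add_apply, h] <;> omega
    have htμ : ∀ i, unitVec μ i = 0 ∨ unitVec μ i = 1 := fun i => by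
      by_cases h : i = μ
      · subst h; simp [unitVec]
      · simp [unitVec, Pi.single_eq_of_ne h]
    have htν : ∀ i, unitVec ν i = 0 ∨ unitVec ν i = 1 := fun i => by
      by_cases h : i = ν
      · subst h; simp [unitVec]
      · simp [unitVec, Pi.single_eq_of_ne h]
    have htμν : ∀ i, (unitVec μ + unitVec ν) i = 0 ∨ (unitVec μ + unitVec ν) i = 1 := fun i => by
      by_cases h : i = μ
      · subst h; simp [unitVec, Pi.single_eq_of_ne hμν]
      · by_cases h' : i = ν
        · subst h'; simp [unitVec, Pi.single_eq_of_ne h]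
        · simp [unitVec, Pi.single_eq_of_ne h, Pi.single_eq_of_ne h']
    have e10 : (tshift (N0 ℓ Mh k P) (unitVec μ) x).1 = Function.update x.1 μ (x.1 μ + 1) := by
      rw [tshift_val_of_mem (hmem _ htμ), unitVec, add_single_eq_update]
    have e01 : (tshift (N0 ℓ Mh k P) (unitVec ν) x).1 = Function.update x.1 ν (x.1 ν + 1) := by
      rw [tshift_val_of_mem (hmem _ htν), unitVec, add_single_eq_update]
    have e11 : (tshift (N0 ℓ Mh k P) (unitVec ν) (tshift (N0 ℓ Mh k P) (unitVec μ) x)).1 =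
        Function.update (Function.update x.1 μ (x.1 μ + 1)) ν (x.1 ν + 1) := by
      rw [tshift_tshift, tshift_val_of_mem (hmem _ htμν), ← add_assoc, unitVec, unitVec, add_single_eq_update, add_single_eq_update,
        Function.update_of_ne hμν.symm]
    exact abs_hF_mixed_diff_le (Dch DT c) hℓ hMh1 hR _ hμν e10 e01 e11
  · -- on a far wall: none of the four sites carries `h`
    push Not at hwall
    obtain ⟨i, hi⟩ := hwall
    have w := fun t ht => hF_tshift_eq_zero_of_wall hℓ hMh hR hP5 (hMh1 := hMh1) (hP4 := hP4) c (x := x) (i := i) hi t ht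
    have h00 : hF (Dch DT c) (cc DT hMh1 hP4 c) x = 0 := by
      have h := w 0 (Or.inl rfl); rwa [tshift_zero] at h
    have h10 : hF (Dch DT c) (cc DT hMh1 hP4 c) (tshift (N0 ℓ Mh k P) (unitVec μ) x) = 0 := by
      refine w _ ?_
      by_cases h : i = μ
      · subst h; simp [unitVec]
      · simp [unitVec, Pi.single_eq_of_ne h]
    have h01 : hF (Dch DT c) (cc DT hMh1 hP4 c) (tshift (N0 ℓ Mh k P) (unitVec ν) x) = 0 := by
      refine w _ ?_
      by_cases h : i = ν
      · subst h; simp [unitVec]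
      · simp [unitVec, Pi.single_eq_of_ne h]
    have h11 : hF (Dch DT c) (cc DT hMh1 hP4 c) (tshift (N0 ℓ Mh k P) (unitVec ν) (tshift (N0 ℓ Mh k P) (unitVec μ) x)) = 0 := by
      rw [tshift_tshift]
      refine w _ ?_
      by_cases h : i = μ
      · subst h; simp [unitVec, Pi.single_eq_of_ne hμν]
      · by_cases h' : i = ν
        · subst h'; simp [unitVec, Pi.single_eq_of_ne h]
        · simp [unitVec, Pi.single_eq_of_ne h, Pi.single_eq_of_ne h']
    rw [h00, h10, h01, h11]; norm_num; exact hC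

/-- the constant `C₂ˣ = C₂ + C₂ᴹ` bounding ALL second lattice differences of `h_□` (pure and mixed). OURS.
[cite: Balaban1984PropagatorsII, p.247 («O(1)»), bookkeeping] -/
noncomputable def C2X (d ℓ : ℕ) : ℝ := C2F d ℓ + C2M d ℓ

/-- `C₂ ≤ C₂ˣ`, `C₂ᴹ ≤ C₂ˣ`, `0 ≤ C₂ˣ`. [cite: Balaban1984PropagatorsII, p.247, bookkeeping] -/
theorem C2X_bounds (d ℓ : ℕ) : C2F d ℓ ≤ C2X d ℓ ∧ C2M d ℓ ≤ C2X d ℓ ∧ 0 ≤ C2X d ℓ := by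
  unfold C2X
  exact ⟨le_add_of_nonneg_right (C2M_nonneg d ℓ), le_add_of_nonneg_left (C2F_nonneg d ℓ), add_nonneg (C2F_nonneg d ℓ) (C2M_nonneg d ℓ)⟩

/-- **THE UNIT STEP OF A FIRST DIFFERENCE OF `h^T_□`**, any two axes `μ, ν` (equal or not):
`|h^T_□(z + e_μ + e_ν) − h^T_□(z + e_μ) − h^T_□(z + e_ν) + h^T_□(z)| ≤ C₂ˣ/(8S/5)²` — for `μ = ν` this is p38's pure second difference at `z + e_μ`,
for `μ ≠ ν` the mixed one above («|∇∇′h_□| ≤ O(1)(ML^jη)^{−2}»). [cite: Balaban1984PropagatorsII, p.247 (2.137) / after (2.134), (2.92) p.239 line 1] -/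
theorem abs_hT_diff_step_le (hℓ : 1 ≤ ℓ) (hMh : 2 ≤ Mh) (hR : 2 * (ℓ + 1) ≤ R) (hP5 : ∀ μ, 5 ≤ P μ) (c : ↥(cubes DT.toDomains))
    (μ ν : Fin (d + 1)) (z : ↥(boxDom (N0 ℓ Mh k P))) :
    |hT DT c (tshift (N0 ℓ Mh k P) (unitVec ν) (tshift (N0 ℓ Mh k P) (unitVec μ) z)) - hT DT c (tshift (N0 ℓ Mh k P) (unitVec μ) z) -
        hT DT c (tshift (N0 ℓ Mh k P) (unitVec ν) z) + hT DT c z| ≤ C2X d ℓ / (8 / 5 * (bigSide ℓ Mh c.1.1 : ℝ)) ^ 2 := by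
  obtain ⟨hF2, hM2, -⟩ := C2X_bounds d ℓ
  have hden : 0 < (8 / 5 * (bigSide ℓ Mh c.1.1 : ℝ)) ^ 2 := by
    have := one_le_bigSide (le_trans (by norm_num) hMh) (ℓ := ℓ) c.1.1
    positivity
  by_cases hμν : μ = ν
  · subst hμν
    -- pure: the second difference at `w = z + e_μ`, `z = w − e_μ`
    set w := tshift (N0 ℓ Mh k P) (unitVec μ) z with hw
    have ez : z = tshift (N0 ℓ Mh k P) (-unitVec μ) w := by
      rw [hw, tshift_tshift, add_neg_cancel, tshift_zero]
    have h := abs_hT_second_diff_le hℓ hMh hR hP5 c μ w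
    rw [← ez] at h
    have e : hT DT c (tshift (N0 ℓ Mh k P) (unitVec μ) w) - hT DT c w - hT DT c w + hT DT c z =
        hT DT c (tshift (N0 ℓ Mh k P) (unitVec μ) w) - 2 * hT DT c w + hT DT c z := by ring
    rw [e]
    exact h.trans (div_le_div_of_nonneg_right hF2 hden.le)
  · exact (abs_hT_mixed_diff_le hℓ hMh hR hP5 c hμν z).trans (div_le_div_of_nonneg_right hM2 hden.le)

end Torus

end Literature.MathematicalPhysics.QuantumFieldTheory.Balaban1983to89.B6Partition118KLevelFineMixed
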